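import Summits.ResolutionOfSingularities.ResolutionOfSingularities.Theorems.HypersurfaceCentreConstruction.Negative.CanonicalGameFalseOfMinimalMoves
import Summits.ResolutionOfSingularities.ResolutionOfSingularities.Theorems.WeightedInvariantHypersurfaceLocalGameEFTPointMoveExceptional
import Summits.ResolutionOfSingularities.ResolutionOfSingularities.Theorems.WeightedInvariantWeightedConstructionFullBlowupRegime
import Summits.ResolutionOfSingularities.ResolutionOfSingularities.Theorems.WeightedInvariantHypersurfaceLocalGameEFTSuccessorRegular

/-!
# `HypersurfaceCentreConstruction` — kill template, SUCCESSOR-CLOSED form (the family continues the play at the successor itself)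

Door crux `stmt-ResolutionOfSingularities-19897`
(`Summit.ResolutionOfSingularities.ResolutionOfSingularities.Theses.WeightedInvariant.HypersurfaceCentreConstruction`, route
`ResolutionOfSingularities/WeightedInvariant`, line `local-engine`, skeleton v3.3, key stub `stub_localWeightedDropEFT4S`).
After-care of res-L1-w43-plan-1 ORDER (o27) / RULING (D15) by res-type-070: sibling of
`…/Negative/CanonicalGameFalseOfMinimalMoves.lean` (p510528; the 400-line cap forbids appending there).  No definitions, proofs only.

[OURS · L1 W4.3 · AI-produced negative knowledge, weaker than expert review; nothing here asserts anything about Hironaka's problem.]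

WHY.  In `canonicalGameClause_false_of_closedMinimalFamily` the family answers a minimal move with a singular successor prime `𝔫` of
`B = cobordantAlgebra' u w` AND an essentially smooth local pull-back layer `(S₁, S', e : B_𝔫 ≃+* S')` onto a member `(S₁, f₁)`.  A census
that simply wants to CONTINUE THE PLAY AT THE SUCCESSOR should not have to build that layer: the successor position `(B_𝔫, g)` is itself
an e.f.t. position — `B` is of finite type over `S` (tree `finiteType_extReesAlgebra_of_eq`, Włodarczyk 2022 §2.3.9), so `B_𝔫` is
essentially of finite type over `k₀` (`essFiniteType_localization_cobordantAlgebra'`, unconditional), and `B_𝔫` is a regular local ring —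
for POINT moves (all weights positive) by res-type-098's K3b-i `LocalGameEFTPointMove.isRegularLocalRing_of_isLocalization`
(`isRegularLocalRing_localization_cobordantAlgebra'_of_forall_pos`); for a general minimal move (some weights zero, positive-dimensional
regular centre) the tree does not yet hold `B/(t⁻¹) ≅ (S ⧸ P)[X]`, so regularity stays a witness the instance supplies.

* `canonicalGameClause_false_of_successorClosedMinimalFamily` — a non-empty family `F` of singular e.f.t. positions over one perfect field
  `k₀` of characteristic `p` in which every MINIMAL move the clause can play (prime `P ∋ f`, `S ⧸ P` regular, minimal system `u` of `𝔪`,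
  weights not all zero whose positively weighted members span `P`, (adm)) has a singular successor prime `𝔫` (`t⁻¹ ∈ 𝔫 ⊇ P·B`, off the
  vertex, `t⁻¹`-saturated factor `g ∈ 𝔫²B_𝔫`) whose OWN position `(B_𝔫, g)` is a member — the two `Prop` instances
  `Algebra.EssFiniteType k₀ B_𝔫`, `IsRegularLocalRing B_𝔫` supplied as witnesses — refutes `CanonicalGameClause p ι J` for every `(ι, J)`
  with (c6) and (c11).  One-line reduction to the closed-family form with `S₁ = S' := B_𝔫`, identity algebra (local, formally smooth,
  e.f.t.), `e := RingEquiv.refl`.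
* `localWeightedDropEFT3_false_of_successorClosedMinimalFamily`, `localWeightedDropEFT4S_false_of_successorClosedMinimalFamily` — the
  keyed candidates (the latter via `not_eft4S_of_not_eft3`).

WHAT A CENSUS INSTANCE NOW OWES: a membership predicate `F`, one member, and per member and per minimal move ONE singular successor prime
whose position lies in `F` (plus the regularity witness off the point-move case) — commutative algebra at one position at a time.  No family
is claimed to exist.
-/

noncomputable section

open IsLocalRing AlgebraicGeometry CategoryTheory Literature.AlgebraicGeometry.Resolution
open Summit.ResolutionOfSingularities.ResolutionOfSingularities.Cruxes.HypersurfaceCentreConstruction.LocalEngine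
open Summit.ResolutionOfSingularities.ResolutionOfSingularities.Theorems

set_option linter.dupNamespace false

namespace Summit.ResolutionOfSingularities.ResolutionOfSingularities.Theorems.HypersurfaceCentreConstruction.Negative


/-- The successor rings of the e.f.t. game are e.f.t.: for `S` essentially of finite type over `k₀`, every local ring
`B_𝔫` of `B = cobordantAlgebra' u w = S[t⁻¹, 𝒥ₙtⁿ]` is essentially of finite type over `k₀` (`B` is of finite type over `S`,
tree `finiteType_extReesAlgebra_of_eq`; localisations and compositions are e.f.t.). [folklore] -/
theorem essFiniteType_localization_cobordantAlgebra' (k₀ : Type) [Field k₀] {S : Type} [CommRing S] [Algebra k₀ S]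
    [Algebra.EssFiniteType k₀ S] {n : ℕ} (u : Fin n → S) (w : Fin n → ℕ)
    (𝔫 : Ideal (cobordantAlgebra' u w)) [𝔫.IsPrime] :
    Algebra.EssFiniteType k₀ (Localization.AtPrime 𝔫) := by
  haveI : Algebra.FiniteType S (cobordantAlgebra' u w) := finiteType_extReesAlgebra_of_eq rfl
  haveI : Algebra.EssFiniteType S (cobordantAlgebra' u w) := inferInstance
  haveI : Algebra.EssFiniteType (cobordantAlgebra' u w) (Localization.AtPrime 𝔫) :=
    Algebra.EssFiniteType.of_isLocalization _ 𝔫.primeCompl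
  haveI : Algebra.EssFiniteType S (Localization.AtPrime 𝔫) :=
    Algebra.EssFiniteType.comp S (cobordantAlgebra' u w) (Localization.AtPrime 𝔫)
  exact Algebra.EssFiniteType.comp k₀ S (Localization.AtPrime 𝔫)

/-- The successor rings of a POINT move are regular: for `S` regular local, `u` a minimal system of `𝔪` and all weights
positive, `B_𝔫` is a regular local ring at every prime `𝔫 ∋ t⁻¹` (res-type-098's K3b-i
`LocalGameEFTPointMove.isRegularLocalRing_of_isLocalization`, Włodarczyk 2022 §2.3.9, restated for `Localization.AtPrime`).
[cite: Wlodarczyk2022, §2.3.9] -/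
theorem isRegularLocalRing_localization_cobordantAlgebra'_of_forall_pos {S : Type} [CommRing S] [IsRegularLocalRing S]
    {n : ℕ} (u : Fin n → S) (w : Fin n → ℕ) (hspan : Ideal.span (Set.range u) = maximalIdeal S)
    (hrank : (maximalIdeal S).spanFinrank = n) (hw : ∀ j, 0 < w j)
    (𝔫 : Ideal (cobordantAlgebra' u w)) [𝔫.IsPrime] (ht : cobordantT' u w ∈ 𝔫) :
    IsRegularLocalRing (Localization.AtPrime 𝔫) :=
  LocalGameEFTPointMove.isRegularLocalRing_of_isLocalization u w hspan hrank hw 𝔫 ht (Localization.AtPrime 𝔫)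

/-- **Successor-closed form of the kill template.**  A non-empty family `F` of singular e.f.t. positions over one perfect
field `k₀` of characteristic `p` such that at every member every MINIMAL move the clause can play (prime `P ∋ f` with
`S ⧸ P` regular, minimal system `u` of `𝔪`, weights not all zero whose positively weighted members span `P`, (adm)) has a
singular successor prime `𝔫` of `B = cobordantAlgebra' u w` (`t⁻¹ ∈ 𝔫 ⊇ P·B`, off the vertex, `t⁻¹`-saturated factor `g` of
`f` with `g ∈ 𝔫²B_𝔫`) whose OWN position `(B_𝔫, g)` is a member — `B_𝔫` e.f.t. over `k₀` and regular, both supplied as `Prop`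
witnesses — refutes `CanonicalGameClause p ι J` for every `(ι, J)` with (c6) and (c11).  One-line reduction to
`canonicalGameClause_false_of_closedMinimalFamily` (`S₁ = S' := B_𝔫`, `e := RingEquiv.refl`, identity algebra: formally
smooth, e.f.t., local). [folklore] -/
theorem canonicalGameClause_false_of_successorClosedMinimalFamily (p : ℕ)
    (ι : (R : Type) → [CommRing R] → R → Ordinal.{0}) (J : (R : Type) → [CommRing R] → R → ℕ → Ideal R)
    (h6 : IotaIsoInvariant ι) (h11 : IotaJEssSmoothCompatible ι J)
    (k₀ : Type) [Field k₀] [CharP k₀ p] [PerfectField k₀]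
    (F : (S : Type) → [CommRing S] → [Algebra k₀ S] → S → Prop)
    (hne : ∃ (S : Type) (_ : CommRing S) (_ : Algebra k₀ S) (_ : Algebra.EssFiniteType k₀ S) (_ : IsRegularLocalRing S)
      (f : S), F S f)
    (hsucc : ∀ (S : Type) [CommRing S] [Algebra k₀ S] [Algebra.EssFiniteType k₀ S] [IsRegularLocalRing S] (f : S), F S f →
      f ≠ 0 ∧ f ∈ (maximalIdeal S) ^ 2 ∧
      ∀ (P : Ideal S) (n : ℕ) (u : Fin n → S) (w : Fin n → ℕ),
        P.IsPrime → IsRegularLocalRing (S ⧸ P) → f ∈ P →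
        Ideal.span (Set.range u) = maximalIdeal S → (maximalIdeal S).spanFinrank = n → (∃ j, 0 < w j) →
        Ideal.span {x | ∃ j, 0 < w j ∧ x = u j} = P →
        (∀ (Q : Ideal S) [Q.IsPrime], P ≤ Q →
          algebraMap S (Localization.AtPrime Q) f ∈ (maximalIdeal (Localization.AtPrime Q)) ^ 2) →
        ∃ (𝔫 : Ideal (cobordantAlgebra' u w)) (_ : 𝔫.IsPrime),
          cobordantT' u w ∈ 𝔫 ∧ P.map (algebraMap S (cobordantAlgebra' u w)) ≤ 𝔫 ∧
          ¬ (extReesAlgebra.vertexIdeal (weightedMonomialIdeal u w) ≤ 𝔫) ∧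
          ∃ (a : ℕ) (g : cobordantAlgebra' u w),
            algebraMap S (cobordantAlgebra' u w) f = cobordantT' u w ^ a * g ∧ ¬ (cobordantT' u w ∣ g) ∧
            algebraMap (cobordantAlgebra' u w) (Localization.AtPrime 𝔫) g ∈ (maximalIdeal (Localization.AtPrime 𝔫)) ^ 2 ∧
            ∃ (_ : Algebra.EssFiniteType k₀ (Localization.AtPrime 𝔫)) (_ : IsRegularLocalRing (Localization.AtPrime 𝔫)),
              F (Localization.AtPrime 𝔫) (algebraMap (cobordantAlgebra' u w) (Localization.AtPrime 𝔫) g)) :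
    ¬ CanonicalGameClause p ι J := by
  refine canonicalGameClause_false_of_closedMinimalFamily p ι J h6 h11 k₀ F hne ?_
  intro S _ _ _ _ f hF
  obtain ⟨hf0, hf2, hmoves⟩ := hsucc S f hF
  refine ⟨hf0, hf2, ?_⟩
  intro P n u w hP hPreg hfP hspan hrank hpos hcentre hadm
  obtain ⟨𝔫, h𝔫, ht, hP𝔫, hv, a, g, hfg, hndvd, hg2, hEFT, hReg, hFsucc⟩ :=
    hmoves P n u w hP hPreg hfP hspan hrank hpos hcentre (fun Q _ hQ => hadm Q hQ)
  refine ⟨𝔫, h𝔫, ht, hP𝔫, hv, a, g, hfg, hndvd, hg2, Localization.AtPrime 𝔫, inferInstance, inferInstance, hEFT, hReg,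
    algebraMap (cobordantAlgebra' u w) (Localization.AtPrime 𝔫) g, hFsucc, Localization.AtPrime 𝔫, inferInstance, hReg,
    Algebra.id _, ?_, inferInstance, inferInstance, RingEquiv.refl _, ?_⟩
  · exact ⟨fun _ h => h⟩
  · rfl

/-- Corollary: a non-empty successor-closed family of singular e.f.t. positions in characteristic `p` refutes H2a‴
`LocalWeightedDropEFT3 p`. [folklore] -/
theorem localWeightedDropEFT3_false_of_successorClosedMinimalFamily (p : ℕ)
    (k₀ : Type) [Field k₀] [CharP k₀ p] [PerfectField k₀]
    (F : (S : Type) → [CommRing S] → [Algebra k₀ S] → S → Prop)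
    (hne : ∃ (S : Type) (_ : CommRing S) (_ : Algebra k₀ S) (_ : Algebra.EssFiniteType k₀ S) (_ : IsRegularLocalRing S)
      (f : S), F S f)
    (hsucc : ∀ (S : Type) [CommRing S] [Algebra k₀ S] [Algebra.EssFiniteType k₀ S] [IsRegularLocalRing S] (f : S), F S f →
      f ≠ 0 ∧ f ∈ (maximalIdeal S) ^ 2 ∧
      ∀ (P : Ideal S) (n : ℕ) (u : Fin n → S) (w : Fin n → ℕ),
        P.IsPrime → IsRegularLocalRing (S ⧸ P) → f ∈ P →
        Ideal.span (Set.range u) = maximalIdeal S → (maximalIdeal S).spanFinrank = n → (∃ j, 0 < w j) →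
        Ideal.span {x | ∃ j, 0 < w j ∧ x = u j} = P →
        (∀ (Q : Ideal S) [Q.IsPrime], P ≤ Q →
          algebraMap S (Localization.AtPrime Q) f ∈ (maximalIdeal (Localization.AtPrime Q)) ^ 2) →
        ∃ (𝔫 : Ideal (cobordantAlgebra' u w)) (_ : 𝔫.IsPrime),
          cobordantT' u w ∈ 𝔫 ∧ P.map (algebraMap S (cobordantAlgebra' u w)) ≤ 𝔫 ∧
          ¬ (extReesAlgebra.vertexIdeal (weightedMonomialIdeal u w) ≤ 𝔫) ∧
          ∃ (a : ℕ) (g : cobordantAlgebra' u w),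
            algebraMap S (cobordantAlgebra' u w) f = cobordantT' u w ^ a * g ∧ ¬ (cobordantT' u w ∣ g) ∧
            algebraMap (cobordantAlgebra' u w) (Localization.AtPrime 𝔫) g ∈ (maximalIdeal (Localization.AtPrime 𝔫)) ^ 2 ∧
            ∃ (_ : Algebra.EssFiniteType k₀ (Localization.AtPrime 𝔫)) (_ : IsRegularLocalRing (Localization.AtPrime 𝔫)),
              F (Localization.AtPrime 𝔫) (algebraMap (cobordantAlgebra' u w) (Localization.AtPrime 𝔫) g)) :
    ¬ LocalWeightedDropEFT3 p := by
  rintro ⟨ι, J, h6, -, -, -, -, h11, hgame, -, -, -⟩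
  exact canonicalGameClause_false_of_successorClosedMinimalFamily p ι J h6 h11 k₀ F hne hsucc hgame

/-- Corollary: a non-empty successor-closed family of singular e.f.t. positions in characteristic `p` refutes the
registered key H2a⁗ `LocalWeightedDropEFT4S p` (via `not_eft4S_of_not_eft3`). [folklore] -/
theorem localWeightedDropEFT4S_false_of_successorClosedMinimalFamily (p : ℕ)
    (k₀ : Type) [Field k₀] [CharP k₀ p] [PerfectField k₀]
    (F : (S : Type) → [CommRing S] → [Algebra k₀ S] → S → Prop)
    (hne : ∃ (S : Type) (_ : CommRing S) (_ : Algebra k₀ S) (_ : Algebra.EssFiniteType k₀ S) (_ : IsRegularLocalRing S)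
      (f : S), F S f)
    (hsucc : ∀ (S : Type) [CommRing S] [Algebra k₀ S] [Algebra.EssFiniteType k₀ S] [IsRegularLocalRing S] (f : S), F S f →
      f ≠ 0 ∧ f ∈ (maximalIdeal S) ^ 2 ∧
      ∀ (P : Ideal S) (n : ℕ) (u : Fin n → S) (w : Fin n → ℕ),
        P.IsPrime → IsRegularLocalRing (S ⧸ P) → f ∈ P →
        Ideal.span (Set.range u) = maximalIdeal S → (maximalIdeal S).spanFinrank = n → (∃ j, 0 < w j) →
        Ideal.span {x | ∃ j, 0 < w j ∧ x = u j} = P →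
        (∀ (Q : Ideal S) [Q.IsPrime], P ≤ Q →
          algebraMap S (Localization.AtPrime Q) f ∈ (maximalIdeal (Localization.AtPrime Q)) ^ 2) →
        ∃ (𝔫 : Ideal (cobordantAlgebra' u w)) (_ : 𝔫.IsPrime),
          cobordantT' u w ∈ 𝔫 ∧ P.map (algebraMap S (cobordantAlgebra' u w)) ≤ 𝔫 ∧
          ¬ (extReesAlgebra.vertexIdeal (weightedMonomialIdeal u w) ≤ 𝔫) ∧
          ∃ (a : ℕ) (g : cobordantAlgebra' u w),
            algebraMap S (cobordantAlgebra' u w) f = cobordantT' u w ^ a * g ∧ ¬ (cobordantT' u w ∣ g) ∧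
            algebraMap (cobordantAlgebra' u w) (Localization.AtPrime 𝔫) g ∈ (maximalIdeal (Localization.AtPrime 𝔫)) ^ 2 ∧
            ∃ (_ : Algebra.EssFiniteType k₀ (Localization.AtPrime 𝔫)) (_ : IsRegularLocalRing (Localization.AtPrime 𝔫)),
              F (Localization.AtPrime 𝔫) (algebraMap (cobordantAlgebra' u w) (Localization.AtPrime 𝔫) g)) :
    ¬ LocalWeightedDropEFT4S p :=
  not_eft4S_of_not_eft3 p (localWeightedDropEFT3_false_of_successorClosedMinimalFamily p k₀ F hne hsucc)

/-! ## rev 2 — WITNESS-FREE form: the successor position is a position (regularity `…LocalGameEFTSuccessorRegular`, p513017)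

With `LocalEngine.isRegularLocalRing_localization_cobordantAlgebra'` (every minimal move, zero weights allowed) and
`essFiniteType_localization_cobordantAlgebra'` both instance witnesses of `canonicalGameClause_false_of_successorClosedMinimalFamily`
are discharged from the move data (`span (range u) = 𝔪`, `𝔪.spanFinrank = n`, `t⁻¹ ∈ 𝔫`): a census instance now owes ONLY the
membership of the successor position. -/

/-- **Kill template, witness-free successor form.**  A non-empty family `F` of singular e.f.t. positions over one perfect field
`k₀` of characteristic `p` such that at every member every MINIMAL move the clause can play (prime `P ∋ f`, `S ⧸ P` regular,
minimal system `u` of `𝔪`, weights not all zero whose positively weighted members span `P`, (adm)) has a singular successor prime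
`𝔫` of `B = cobordantAlgebra' u w` (`t⁻¹ ∈ 𝔫 ⊇ P·B`, off the vertex, `t⁻¹`-saturated factor `g ∈ 𝔫²B_𝔫`) with `(B_𝔫, g) ∈ F`,
refutes `CanonicalGameClause p ι J` for every `(ι, J)` with (c6) and (c11).  (`B_𝔫` is e.f.t. over `k₀` and regular local by
`essFiniteType_localization_cobordantAlgebra'` / `isRegularLocalRing_localization_cobordantAlgebra'`.) [folklore] -/
theorem canonicalGameClause_false_of_successorMemberMinimalFamily (p : ℕ)
    (ι : (R : Type) → [CommRing R] → R → Ordinal.{0}) (J : (R : Type) → [CommRing R] → R → ℕ → Ideal R)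
    (h6 : IotaIsoInvariant ι) (h11 : IotaJEssSmoothCompatible ι J)
    (k₀ : Type) [Field k₀] [CharP k₀ p] [PerfectField k₀]
    (F : (S : Type) → [CommRing S] → [Algebra k₀ S] → S → Prop)
    (hne : ∃ (S : Type) (_ : CommRing S) (_ : Algebra k₀ S) (_ : Algebra.EssFiniteType k₀ S) (_ : IsRegularLocalRing S)
      (f : S), F S f)
    (hmem : ∀ (S : Type) [CommRing S] [Algebra k₀ S] [Algebra.EssFiniteType k₀ S] [IsRegularLocalRing S] (f : S), F S f →
      f ≠ 0 ∧ f ∈ (maximalIdeal S) ^ 2 ∧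
      ∀ (P : Ideal S) (n : ℕ) (u : Fin n → S) (w : Fin n → ℕ),
        P.IsPrime → IsRegularLocalRing (S ⧸ P) → f ∈ P →
        Ideal.span (Set.range u) = maximalIdeal S → (maximalIdeal S).spanFinrank = n → (∃ j, 0 < w j) →
        Ideal.span {x | ∃ j, 0 < w j ∧ x = u j} = P →
        (∀ (Q : Ideal S) [Q.IsPrime], P ≤ Q →
          algebraMap S (Localization.AtPrime Q) f ∈ (maximalIdeal (Localization.AtPrime Q)) ^ 2) →
        ∃ (𝔫 : Ideal (cobordantAlgebra' u w)) (_ : 𝔫.IsPrime),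
          cobordantT' u w ∈ 𝔫 ∧ P.map (algebraMap S (cobordantAlgebra' u w)) ≤ 𝔫 ∧
          ¬ (extReesAlgebra.vertexIdeal (weightedMonomialIdeal u w) ≤ 𝔫) ∧
          ∃ (a : ℕ) (g : cobordantAlgebra' u w),
            algebraMap S (cobordantAlgebra' u w) f = cobordantT' u w ^ a * g ∧ ¬ (cobordantT' u w ∣ g) ∧
            algebraMap (cobordantAlgebra' u w) (Localization.AtPrime 𝔫) g ∈ (maximalIdeal (Localization.AtPrime 𝔫)) ^ 2 ∧
            F (Localization.AtPrime 𝔫) (algebraMap (cobordantAlgebra' u w) (Localization.AtPrime 𝔫) g)) :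
    ¬ CanonicalGameClause p ι J := by
  refine canonicalGameClause_false_of_successorClosedMinimalFamily p ι J h6 h11 k₀ F hne ?_
  intro S _ _ _ _ f hF
  obtain ⟨hf0, hf2, hmoves⟩ := hmem S f hF
  refine ⟨hf0, hf2, ?_⟩
  intro P n u w hP hPreg hfP hspan hrank hpos hcentre hadm
  obtain ⟨𝔫, h𝔫, ht, hP𝔫, hv, a, g, hfg, hndvd, hg2, hFsucc⟩ :=
    hmoves P n u w hP hPreg hfP hspan hrank hpos hcentre (fun Q _ hQ => hadm Q hQ)
  exact ⟨𝔫, h𝔫, ht, hP𝔫, hv, a, g, hfg, hndvd, hg2, essFiniteType_localization_cobordantAlgebra' k₀ u w 𝔫,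
    isRegularLocalRing_localization_cobordantAlgebra' u w hspan hrank 𝔫 ht, hFsucc⟩

/-- Corollary: a non-empty family of singular e.f.t. positions in characteristic `p`, closed under passing to a singular successor
position of every minimal move, refutes H2a‴ `LocalWeightedDropEFT3 p`. [folklore] -/
theorem localWeightedDropEFT3_false_of_successorMemberMinimalFamily (p : ℕ)
    (k₀ : Type) [Field k₀] [CharP k₀ p] [PerfectField k₀]
    (F : (S : Type) → [CommRing S] → [Algebra k₀ S] → S → Prop)
    (hne : ∃ (S : Type) (_ : CommRing S) (_ : Algebra k₀ S) (_ : Algebra.EssFiniteType k₀ S) (_ : IsRegularLocalRing S)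
      (f : S), F S f)
    (hmem : ∀ (S : Type) [CommRing S] [Algebra k₀ S] [Algebra.EssFiniteType k₀ S] [IsRegularLocalRing S] (f : S), F S f →
      f ≠ 0 ∧ f ∈ (maximalIdeal S) ^ 2 ∧
      ∀ (P : Ideal S) (n : ℕ) (u : Fin n → S) (w : Fin n → ℕ),
        P.IsPrime → IsRegularLocalRing (S ⧸ P) → f ∈ P →
        Ideal.span (Set.range u) = maximalIdeal S → (maximalIdeal S).spanFinrank = n → (∃ j, 0 < w j) →
        Ideal.span {x | ∃ j, 0 < w j ∧ x = u j} = P →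
        (∀ (Q : Ideal S) [Q.IsPrime], P ≤ Q →
          algebraMap S (Localization.AtPrime Q) f ∈ (maximalIdeal (Localization.AtPrime Q)) ^ 2) →
        ∃ (𝔫 : Ideal (cobordantAlgebra' u w)) (_ : 𝔫.IsPrime),
          cobordantT' u w ∈ 𝔫 ∧ P.map (algebraMap S (cobordantAlgebra' u w)) ≤ 𝔫 ∧
          ¬ (extReesAlgebra.vertexIdeal (weightedMonomialIdeal u w) ≤ 𝔫) ∧
          ∃ (a : ℕ) (g : cobordantAlgebra' u w),
            algebraMap S (cobordantAlgebra' u w) f = cobordantT' u w ^ a * g ∧ ¬ (cobordantT' u w ∣ g) ∧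
            algebraMap (cobordantAlgebra' u w) (Localization.AtPrime 𝔫) g ∈ (maximalIdeal (Localization.AtPrime 𝔫)) ^ 2 ∧
            F (Localization.AtPrime 𝔫) (algebraMap (cobordantAlgebra' u w) (Localization.AtPrime 𝔫) g)) :
    ¬ LocalWeightedDropEFT3 p := by
  rintro ⟨ι, J, h6, -, -, -, -, h11, hgame, -, -, -⟩
  exact canonicalGameClause_false_of_successorMemberMinimalFamily p ι J h6 h11 k₀ F hne hmem hgame

/-- Corollary: the same family refutes the registered key H2a⁗ `LocalWeightedDropEFT4S p` (via `not_eft4S_of_not_eft3`). [folklore] -/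
theorem localWeightedDropEFT4S_false_of_successorMemberMinimalFamily (p : ℕ)
    (k₀ : Type) [Field k₀] [CharP k₀ p] [PerfectField k₀]
    (F : (S : Type) → [CommRing S] → [Algebra k₀ S] → S → Prop)
    (hne : ∃ (S : Type) (_ : CommRing S) (_ : Algebra k₀ S) (_ : Algebra.EssFiniteType k₀ S) (_ : IsRegularLocalRing S)
      (f : S), F S f)
    (hmem : ∀ (S : Type) [CommRing S] [Algebra k₀ S] [Algebra.EssFiniteType k₀ S] [IsRegularLocalRing S] (f : S), F S f →
      f ≠ 0 ∧ f ∈ (maximalIdeal S) ^ 2 ∧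
      ∀ (P : Ideal S) (n : ℕ) (u : Fin n → S) (w : Fin n → ℕ),
        P.IsPrime → IsRegularLocalRing (S ⧸ P) → f ∈ P →
        Ideal.span (Set.range u) = maximalIdeal S → (maximalIdeal S).spanFinrank = n → (∃ j, 0 < w j) →
        Ideal.span {x | ∃ j, 0 < w j ∧ x = u j} = P →
        (∀ (Q : Ideal S) [Q.IsPrime], P ≤ Q →
          algebraMap S (Localization.AtPrime Q) f ∈ (maximalIdeal (Localization.AtPrime Q)) ^ 2) →
        ∃ (𝔫 : Ideal (cobordantAlgebra' u w)) (_ : 𝔫.IsPrime),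
          cobordantT' u w ∈ 𝔫 ∧ P.map (algebraMap S (cobordantAlgebra' u w)) ≤ 𝔫 ∧
          ¬ (extReesAlgebra.vertexIdeal (weightedMonomialIdeal u w) ≤ 𝔫) ∧
          ∃ (a : ℕ) (g : cobordantAlgebra' u w),
            algebraMap S (cobordantAlgebra' u w) f = cobordantT' u w ^ a * g ∧ ¬ (cobordantT' u w ∣ g) ∧
            algebraMap (cobordantAlgebra' u w) (Localization.AtPrime 𝔫) g ∈ (maximalIdeal (Localization.AtPrime 𝔫)) ^ 2 ∧
            F (Localization.AtPrime 𝔫) (algebraMap (cobordantAlgebra' u w) (Localization.AtPrime 𝔫) g)) :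
    ¬ LocalWeightedDropEFT4S p :=
  not_eft4S_of_not_eft3 p (localWeightedDropEFT3_false_of_successorMemberMinimalFamily p k₀ F hne hmem)

end Summit.ResolutionOfSingularities.ResolutionOfSingularities.Theorems.HypersurfaceCentreConstruction.Negative

end
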